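import Summits.QuantumAdvantage.QuantumAdvantage.Theorems.InnerDegreeLawsJ

set_option linter.dupNamespace false

/-!
# LIVENESS SEPARATION, part F (lens 4, g28 cycle 4) — LAW R with a second exceptional register DEAD on the rectangle

Blocker `X = AbsorptionDial.NoPerfectPolyOdd` (item 28487).  The tree's LAW R (`InnerDegreeDial.rectRank_le_of_perfect`, `loss_of_rectRank`,
`loss_of_columnSaturatedRectangle`) assumes ALL registers but `g₀` are `k`-form and uses perfection at every input.  Its proof needs the win bit
only AT THE RECTANGLE POINTS; this part records that unbundling and the two-exceptional-register corollary used by NODE-g28 §5d (claim T1):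

* `rectRank_le_of_winsOn` — registers `k`-form except `g₀`, the strategy WINS AT EVERY RECTANGLE POINT `bor (X i) (Y j)` (nothing assumed
  elsewhere) ⇒ `rank rect(1_{LF_{g₀}}) ≤ (n+1)·2p^k + 1` (the tree proof verbatim, with the deletion identity `ringWinU_silence` read at rectangle
  points instead of `perfect_iff_lossSet`);
* `loss_of_rectRank_deadSecond` — registers `k`-form except `g₀` AND `g₁`, register `g₁` DEAD (`liveCut = false`) at every rectangle point,
  `rank rect(1_{LF_{g₀}}) > (n+1)·2p^k + 1` ⇒ the strategy is not perfect (silence `g₁`: the silenced strategy is `k`-form except `g₀` and, by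
  `ringWinU_silence`, wins wherever the original wins and `g₁` is dead);
* `loss_of_columnSaturatedRectangle_deadSecond` — the column-saturated kill (`rank_famPat_flat_ge`) in the same two-register setting.

With part E (`LivenessSeparation.flat_separation`: off the ends configuration two cuts are separated dead/live on a residue class of a flat
block) this is the kernel skeleton of T1: `TwoQuadNoPerfectOdd` off the ends reduces to the one-quadratic law (c0) run on that class.
-/

open Finset
open Summit.QuantumAdvantage.AdviceFreeQNC0
open Summit.QuantumAdvantage.QuantumAdvantage.Theorems.InnerDegreeDial

namespace Summit.QuantumAdvantage.QuantumAdvantage.Theorems.LivenessSeparation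

variable {p : ℕ} [Fact p.Prime]
variable {n : ℕ}

/-! ### §1 LAW R from wins on the rectangle only -/

/-- **LAW R, local form.**  Registers `k`-form except `g₀`; the strategy wins at every point of the combinatorial rectangle
`bor (X i) (Y j)` (disjoint supports).  Then the rectangle pattern of `g₀`'s live firing set has rank `≤ (n+1)·2p^k + 1` over `𝔽₂(μ_{3p})`.
(Proof = the tree's `rectRank_le_of_perfect`, reading the deletion identity `ringWinU_silence` at the rectangle points.) -/
theorem rectRank_le_of_winsOn (hp5 : 5 ≤ p) {k : ℕ} {ι ι' : Type*} [Fintype ι] [Fintype ι'] (c : ℕ)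
    (y : Fin (n + 1) → (Fin n → Bool) → Bool) (g₀ : Fin (n + 1))
    (lam : Fin (n + 1) → Fin k → Fin n → ZMod p) (F : Fin (n + 1) → (Fin k → ZMod p) → Bool)
    (hF : ∀ g, g ≠ g₀ → ∀ u, y g u = F g (fun j => ∑ i, if u i = true then lam g j i else 0))
    (X : ι → Fin n → Bool) (Y : ι' → Fin n → Bool) (hd : ∀ i j l, ¬ (X i l = true ∧ Y j l = true))
    (hwin : ∀ i j, ringWinU c y (bor (X i) (Y j)) = true) :
    (rect (Kp p) (fun u => y g₀ u && liveCut c u g₀) X Y).rank ≤ (n + 1) * (p ^ k * 2) + 1 := by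
  classical
  obtain ⟨hK, ω, ζ, hω, hζ⟩ := Coset21.exists_charTwo_roots p hp5
  haveI := hK
  set F' : Fin (n + 1) → (Fin k → ZMod p) → Bool := Function.update F g₀ (fun _ => false) with hF'
  set κ : Fin (n + 1) → ℕ := fun g => c + g.val with hκ
  set w : Fin (n + 1) → Fin n → ℕ := fun g i => Coset21.CharTwoKill.ww g.val i with hw
  -- (1) the silenced strategy is `k`-form with table `F'`
  have hy' : ∀ g u, silence y g₀ g u = F' g (Coset21.CharTwoKill.kForm lam g u) := by
    intro g u
    unfold silence Coset21.CharTwoKill.kForm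
    by_cases hg : g = g₀
    · subst hg
      simp [hF']
    · rw [Function.update_of_ne hg, hF', Function.update_of_ne hg]
      exact hF g hg u
  -- (2) the char-two expansion of the silenced fire count
  have hexp : ∀ u, (((univ.filter fun g : Fin (n + 1) =>
        silence y g₀ g u = true ∧ (c + g.val + walkExp u g.val) % 3 ≠ 0).card : ℕ) : Kp p)
      = Coset21.CharTwoKill.WsumK ω ζ hω lam F' κ w u := by
    intro u
    rw [← Coset21.CharTwoKill.card_fire_eq_WsumK ω ζ hω lam F' κ w hp5 hζ u]
    congr 2
    refine filter_congr fun g _ => ?_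
    rw [hy' g u, Coset21.CharTwoKill.walkExp_eq_sum]
    unfold Coset21.CharTwoKill.wForm
    simp only [hκ, hw, add_assoc]
  -- (3) pointwise: the live firing indicator is `1 + W'`
  have h11 : (1 : Kp p) + 1 = 0 := CharTwo.add_self_eq_zero 1
  have hpt : ∀ i j, (if (y g₀ (bor (X i) (Y j)) && liveCut c (bor (X i) (Y j)) g₀) = true then (1 : Kp p) else 0)
      = 1 + Coset21.CharTwoKill.WsumK ω ζ hω lam F' κ w (bor (X i) (Y j)) := by
    intro i j
    set u := bor (X i) (Y j) with hu
    have hl : ringWinU c (silence y g₀) u = !(y g₀ u && liveCut c u g₀) := by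
      have h := ringWinU_silence c y g₀ u
      rw [hwin i j] at h
      revert h
      cases ringWinU c (silence y g₀) u <;> cases (y g₀ u && liveCut c u g₀) <;> simp
    unfold ringWinU at hl
    rw [← hexp u, CharP.cast_eq_mod (Kp p) 2]
    set N := (univ.filter fun g : Fin (n + 1) =>
      silence y g₀ g u = true ∧ (c + g.val + walkExp u g.val) % 3 ≠ 0).card with hN
    cases hb : (y g₀ u && liveCut c u g₀)
    · rw [hb] at hl
      have h1 : N % 2 = 1 := by simpa using hl
      rw [h1, Nat.cast_one, h11]
      simp
    · rw [hb] at hl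
      have h0 : N % 2 = 0 := by
        have : ¬ (N % 2 = 1) := by simpa using hl
        omega
      rw [h0, Nat.cast_zero, add_zero]
      simp
  -- (4) the matrix identity: all-ones + one rank-one matrix per term
  set V : Coset21.CharTwoKill.TermK p (Fin (n + 1)) k → Matrix ι ι' (Kp p) := fun t =>
    Matrix.vecMulVec
      (fun i => Coset21.CharTwoKill.coefK ω ζ hω F' κ t
        * Coset21.CharTwoKill.cubeChar (Coset21.CharTwoKill.zvalK ω ζ hω lam w t) (X i))
      (fun j => Coset21.CharTwoKill.cubeChar (Coset21.CharTwoKill.zvalK ω ζ hω lam w t) (Y j))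
    with hV
  have hmat : rect (Kp p) (fun u => y g₀ u && liveCut c u g₀) X Y
      = Matrix.vecMulVec (fun _ => (1 : Kp p)) (fun _ => 1) + ∑ t, V t := by
    ext i j
    rw [rect, Matrix.of_apply, hpt i j, Matrix.add_apply, Matrix.vecMulVec_apply, one_mul, Matrix.sum_apply]
    unfold Coset21.CharTwoKill.WsumK
    congr 1
    refine sum_congr rfl fun t _ => ?_
    simp only [hV, Matrix.vecMulVec_apply]
    rw [cubeChar_bor _ _ _ (hd i j), mul_assoc]
  rw [hmat]
  refine (rank_add_le' _ _).trans ?_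
  have h1 : (Matrix.vecMulVec (fun _ : ι => (1 : Kp p)) (fun _ : ι' => 1)).rank ≤ 1 :=
    Matrix.rank_vecMulVec_le _ _
  have h2 : (∑ t, V t).rank ≤ ∑ t ∈ (univ : Finset (Coset21.CharTwoKill.TermK p (Fin (n + 1)) k)), 1 :=
    (rank_sum_le' univ V).trans (sum_le_sum fun t _ => by rw [hV]; exact Matrix.rank_vecMulVec_le _ _)
  rw [sum_const, smul_eq_mul, mul_one, card_univ, Coset21.CharTwoKill.card_TermK, Fintype.card_fin] at h2
  omega

/-! ### §2 A second exceptional register, dead on the rectangle -/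

/-- **LAW R with a dead second register.**  Registers `k`-form except `g₀` and `g₁` (`g₁ ≠ g₀`, its table arbitrary); `g₁` is DEAD at every
rectangle point; if the rectangle pattern of `g₀`'s live firing set has rank `> (n+1)·2p^k + 1`, the strategy is not perfect. -/
theorem loss_of_rectRank_deadSecond (hp5 : 5 ≤ p) {k : ℕ} {ι ι' : Type*} [Fintype ι] [Fintype ι'] (c : ℕ)
    (y : Fin (n + 1) → (Fin n → Bool) → Bool) (g₀ g₁ : Fin (n + 1)) (hg : g₁ ≠ g₀)
    (lam : Fin (n + 1) → Fin k → Fin n → ZMod p) (F : Fin (n + 1) → (Fin k → ZMod p) → Bool)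
    (hF : ∀ g, g ≠ g₀ → g ≠ g₁ → ∀ u, y g u = F g (fun j => ∑ i, if u i = true then lam g j i else 0))
    (X : ι → Fin n → Bool) (Y : ι' → Fin n → Bool) (hd : ∀ i j l, ¬ (X i l = true ∧ Y j l = true))
    (hdead : ∀ i j, liveCut c (bor (X i) (Y j)) g₁ = false)
    (hrank : (n + 1) * (p ^ k * 2) + 1 < (rect (Kp p) (fun u => y g₀ u && liveCut c u g₀) X Y).rank) :
    ∃ u, ringWinU c y u = false := by
  classical
  by_contra hno
  push Not at hno
  have hperf : ∀ u, ringWinU c y u = true := fun u => by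
    cases h : ringWinU c y u
    · exact absurd h (hno u)
    · rfl
  -- silence `g₁`: `k`-form except `g₀`, wins on the rectangle, same `g₀` pattern
  set y₁ := silence y g₁ with hy₁
  set F₁ : Fin (n + 1) → (Fin k → ZMod p) → Bool := Function.update F g₁ (fun _ => false) with hF₁
  have hF' : ∀ g, g ≠ g₀ → ∀ u, y₁ g u = F₁ g (fun j => ∑ i, if u i = true then lam g j i else 0) := by
    intro g hg0 u
    by_cases h1 : g = g₁
    · subst h1
      simp [hy₁, silence, hF₁]
    · rw [hy₁, silence, Function.update_of_ne h1, hF₁, Function.update_of_ne h1]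
      exact hF g hg0 h1 u
  have hwin : ∀ i j, ringWinU c y₁ (bor (X i) (Y j)) = true := by
    intro i j
    have h := ringWinU_silence c y g₁ (bor (X i) (Y j))
    rw [hperf, hdead i j, Bool.and_false, Bool.xor_false] at h
    rw [hy₁]
    exact h.symm
  have hsame : rect (Kp p) (fun u => y₁ g₀ u && liveCut c u g₀) X Y = rect (Kp p) (fun u => y g₀ u && liveCut c u g₀) X Y := by
    ext i j
    rw [rect, rect, Matrix.of_apply, Matrix.of_apply, hy₁, silence, Function.update_of_ne hg.symm]
  have hle := rectRank_le_of_winsOn hp5 c y₁ g₀ lam F₁ hF' X Y hd hwin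
  rw [hsame] at hle
  exact absurd hle (not_le.mpr hrank)

/-- **THE COLUMN-SATURATED RECTANGLE KILL with a dead second register** (the tree's `loss_of_columnSaturatedRectangle` in the
two-exceptional-register setting of NODE-g28 §5d: `g₀` live on the rectangle and firing through row tables `G_i` against a full column flat,
`g₁` dead on the rectangle, everything else `k`-form). -/
theorem loss_of_columnSaturatedRectangle_deadSecond (hp5 : 5 ≤ p) {k r : ℕ} {ι : Type*} [Fintype ι] (c : ℕ)
    (y : Fin (n + 1) → (Fin n → Bool) → Bool) (g₀ g₁ : Fin (n + 1)) (hg : g₁ ≠ g₀)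
    (lam : Fin (n + 1) → Fin k → Fin n → ZMod p) (F : Fin (n + 1) → (Fin k → ZMod p) → Bool)
    (hF : ∀ g, g ≠ g₀ → g ≠ g₁ → ∀ u, y g u = F g (fun j => ∑ i, if u i = true then lam g j i else 0))
    (X : ι → Fin n → Bool) (Y : (Fin (r + 1) → ZMod p) → Fin n → Bool) (hd : ∀ i w l, ¬ (X i l = true ∧ Y w l = true))
    (hdead : ∀ i w, liveCut c (bor (X i) (Y w)) g₁ = false)
    (G : ι → ZMod p → Bool) (hG : ∀ i, ∃ b₁ b₂, G i b₁ ≠ G i b₂)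
    (a : ι → Fin r → ZMod p) (ha : Function.Injective a)
    (w₀ : Fin (r + 1) → ZMod p) (N N' : Matrix (Fin (r + 1)) (Fin (r + 1)) (ZMod p)) (hN : N * N' = 1)
    (hpat : ∀ i w, y g₀ (bor (X i) (Y w)) = G i (lineRep p r (a i) ⬝ᵥ (N.mulVec w + w₀)))
    (hlive : ∀ i w, liveCut c (bor (X i) (Y w)) g₀ = true)
    (ht : (n + 1) * (p ^ k * 2) + 1 < Fintype.card ι) :
    ∃ u, ringWinU c y u = false := by
  classical
  obtain ⟨hK, ω, -, hω, -⟩ := Coset21.exists_charTwo_roots p hp5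
  haveI := hK
  refine loss_of_rectRank_deadSecond hp5 c y g₀ g₁ hg lam F hF X Y hd hdead (lt_of_lt_of_le ht ?_)
  have hrect : rect (Kp p) (fun u => y g₀ u && liveCut c u g₀) X Y
      = Matrix.of fun i (w : Fin (r + 1) → ZMod p) =>
          (fun i t => if G i t = true then (1 : Kp p) else 0) i (lineRep p r (a i) ⬝ᵥ (N.mulVec w + w₀)) := by
    ext i w
    rw [rect, Matrix.of_apply, Matrix.of_apply]
    simp only [hpat i w, hlive i w, Bool.and_true]
  rw [hrect]
  refine rank_famPat_flat_ge hp5 hω a ha (fun i t => if G i t = true then (1 : Kp p) else 0) ?_ w₀ N N' hN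
  intro i
  obtain ⟨b₁, b₂, hb⟩ := hG i
  refine ⟨b₁, b₂, ?_⟩
  intro h
  apply hb
  cases h1 : G i b₁ <;> cases h2 : G i b₂ <;> simp_all

end Summit.QuantumAdvantage.QuantumAdvantage.Theorems.LivenessSeparation
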